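import Literature.NumberTheory.EllipticCurves.DivisionPolynomialMultiplication
import Literature.NumberTheory.EllipticCurves.CanonicalPAdicHeightParallelogramProofs
import HarnessLib

/-!
# Ayad's lemma: `φₙ(P)` and `ψₙ(P)` are coprime at every place where `P` has non-singular reduction;
# the exact denominator of `x(nP)` for an integral point (proofs only)

Topic `NumberTheory/EllipticCurves` (trunk T-NT-EC); a proofs-only file (theorems only, no definition, no
named fact). Write `nP = (φₙ(P)/ψₙ(P)², ωₙ(P)/ψₙ(P)³)` with the division polynomials `φₙ, ψₙ`
(Mathlib `WeierstrassCurve.φ`, `WeierstrassCurve.ψ`) and `ωₙ` (the tree's `UnivEC.ω`, specialised as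
`WeierstrassCurve.Affine.Point.ωEval`; multiplication formula
`WeierstrassCurve.Affine.Point.zsmul_some_eq_of_evalEval_ψ_ne_zero`, file
`DivisionPolynomialMultiplication`). **Ayad's lemma** (M. Ayad, *Points S-entiers des courbes elliptiques*,
Manuscripta Math. 76 (1992); restated and reproved in Naskręcki–Verzobio, *Common valuations of division
polynomials*, Thm. 1.1 (non-singular case) and Prop. 3.6 with Rem. 3.7 «This proposition was proved for
number fields by Ayad», and used verbatim in Stange, *Integral points on elliptic curves and explicit
valuations of division polynomials*, §5 proof of Thm. 12 «A theorem of Ayad implies that since `P` has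
non-zero non-singular reduction, at least one of `v(Ψₙ)` and `v(φₙ)` is zero for each `n`» and §10 proof
of Lemma 29 «`gₙ = gcd(φₙ, Ψₙ)` is supported only on primes for which `P` has singular reduction … In this
case `v(Wₙ) = v(Dₙ)`»): for a point `P` with integral coordinates and NON-SINGULAR reduction at a place
`v` and every `n ≠ 0`, `min(v(ψₙ(P)), v(φₙ(P))) = 0`; consequently for an integral point of `E(ℚ)` with
non-singular reduction at every prime dividing `ψₙ(P)`, `φₙ(P)` and `ψₙ(P)` are coprime integers and the
denominator of `x(nP)` is EXACTLY `ψₙ(P)²` (Stange's `v(Wₙ) = v(Dₙ)`).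

## Proof (one line, from the tree's Jacobian representatives; no minimality hypothesis)
Reduce modulo `v`: `P̄` is a non-singular affine point of the reduced cubic `W̄`, and by
`WeierstrassCurve.Affine.Point.nonsingular_smulTriple` (Silverman *AEC* Ex. 3.7(d), proved in
`DivisionPolynomialMultiplication` for every non-singular point of every Weierstrass cubic over a field,
smooth or not) the triple `(φₙ(P̄), ωₙ(P̄), ψₙ(P̄))` is a NON-SINGULAR Jacobian representative of `n • P̄`;
a non-singular representative with `Z = 0` has `X ≠ 0` and `Y ≠ 0` (Mathlib
`WeierstrassCurve.Jacobian.X_ne_zero_of_Z_eq_zero`, `Y_ne_zero_of_Z_eq_zero`). Since `φₙ, ψₙ, ωₙ`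
commute with ring maps, `ψₙ(P) ≡ 0` forces `φₙ(P), ωₙ(P) ≢ 0 (mod v)`. The published statements assume a
`v`-minimal model; the argument does not (a non-minimal integral model only makes non-singular reduction
of `P` a stronger hypothesis).

## Contents
* `WeierstrassCurve.evalEval_φ_ne_zero_of_evalEval_ψ_eq_zero`, `WeierstrassCurve.ωEval_ne_zero_of_evalEval_ψ_eq_zero`
  — over a field: `ψₙ(Q) = 0`, `Q` non-singular, `n ≠ 0` ⇒ `φₙ(Q) ≠ 0`, `ωₙ(Q) ≠ 0`.
* `Literature.NumberTheory.EllipticCurves.UnivEC.map_ev` — naturality of the specialisation map of the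
  universal pointed curve (so `ωₙ` commutes with ring maps, as `φₙ, ψₙ` do by Mathlib's `map_φ`, `map_ψ`).
* `WeierstrassCurve.map_evalEval_φ_ne_zero_of_map_evalEval_ψ_eq_zero`, `…map_ev_ω_ne_zero_…` — along any
  ring map `f : R → k` to a field under which `Q` becomes a non-singular point of `W.map f` ("reduction"):
  `f(ψₙ(Q)) = 0 ⇒ f(φₙ(Q)) ≠ 0 ∧ f(ωₙ(Q)) ≠ 0`; `WeierstrassCurve.isUnit_evalEval_φ_of_evalEval_ψ_mem_maximalIdeal`
  — local-ring form **(Ayad's lemma)**; `WeierstrassCurve.not_dvd_evalEval_φ_of_dvd_evalEval_ψ` — over `ℤ`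
  with the reduction taken in `ZMod ℓ`.
* `WeierstrassCurve.norm_evalEval_φ_eq_one_of_norm_evalEval_ψ_lt_one` — over `ℚ` at a prime `ℓ`, in the
  vocabulary of the `p`-adic height files (`HasNonsingularReductionAt ℓ x y`, `localModel`,
  `hasNonsingularReduction_localModel_iff`): `‖ψₙ(P)‖_ℓ < 1 ⇒ ‖φₙ(P)‖_ℓ = 1 ∧ ‖ωₙ(P)‖_ℓ = 1` for an
  `ℓ`-integral point with non-singular reduction.
* `WeierstrassCurve.isCoprime_evalEval_φ_ψ_of_zmod`, `WeierstrassCurve.isCoprime_evalEval_φ_ψ` — for an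
  integral model over `ℤ` and an integral point: `IsCoprime (φₙ(P)) (ψₙ(P))` as soon as `P` is non-singular
  modulo every prime dividing `ψₙ(P)` (reduction in `ZMod ℓ`, resp. `HasNonsingularReductionAt ℓ`);
  `WeierstrassCurve.Affine.Point.exists_zsmul_eq_and_den_eq_sq` — **the exact denominator**
  `den x(nP) = ψₙ(P)²` together with `n • P = (φₙ/ψₙ², ·)`.

## References
* [Ayad1992] M. Ayad, *Points S-entiers des courbes elliptiques*, Manuscripta Math. 76 (1992) 305–324
  (the original; paywalled, acquisition acq-11408 — formalised from the two restating sources below).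
* [NaskreckiVerzobio2022] B. Naskręcki, M. Verzobio, *Common valuations of division polynomials*,
  Proc. Roy. Soc. Edinburgh A 155 (2025), arXiv:2203.02015: Thm. 1.1 (non-singular case
  `k_{v,n} = min(0, n² v(x(P)))`), Prop. 3.6, Rem. 3.7 (arXiv numbering).
* [Stange2016] K. E. Stange, *Integral points on elliptic curves and explicit valuations of division
  polynomials*, Canad. J. Math. 68 (2016), arXiv:1108.3051: §5 proof of Thm. 12; §10 Lemma 29 and its
  proof (arXiv numbering).
* [SilvermanAEC2009] J. H. Silverman, *The Arithmetic of Elliptic Curves*, 2nd ed., Exercise 3.7(d)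
  (the multiplication formula), VII.2 (reduction of points).
-/

noncomputable section

open Polynomial WeierstrassCurve

namespace Literature.NumberTheory.EllipticCurves.UnivEC

/-- **Naturality of the specialisation map** `ev : ℤ[A₁, A₂, A₃, A₄, X, Y] → S` of the universal pointed
Weierstrass curve: for a ring map `f : S → S'`, `f ∘ ev_{(W; x₀, y₀)} = ev_{(f W; f x₀, f y₀)}`. In particular
the universal `ωₙ` specialises compatibly with ring maps (as `φₙ`, `ψₙ` do, `map_φ`, `map_ψ`): the division
polynomials are universal polynomials in `ℤ[a₁, …, a₆, x, y]`. [cite: SilvermanAEC2009, Exercise 3.7(a)–(b) (ψₙ, φₙ, ωₙ ∈ ℤ[a₁,…,a₆,x,y])] -/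
theorem map_ev {S S' : Type*} [CommRing S] [CommRing S'] (f : S →+* S') (W : WeierstrassCurve S)
    (x₀ y₀ : S) (u : U) : f (ev W x₀ y₀ u) = ev (W.map f) (f x₀) (f y₀) u := by
  have key : f.comp (ev W x₀ y₀) = ev (W.map f) (f x₀) (f y₀) := by
    rw [ev, MvPolynomial.comp_eval₂Hom, ev]
    congr 1
    · exact RingHom.ext_int _ _
    · funext i
      fin_cases i <;> rfl
  exact DFunLike.congr_fun key u

end Literature.NumberTheory.EllipticCurves.UnivEC

namespace WeierstrassCurve

open Literature.NumberTheory.EllipticCurves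

/-! ### Over a field: a non-singular point killed by `ψₙ` is not killed by `φₙ`, `ωₙ` -/

section Field

variable {F : Type*} [Field F] {V : WeierstrassCurve F} {x₀ y₀ : F}

/-- The case `n = m ≥ 1`: `(φₘ(Q), ωₘ(Q), ψₘ(Q))` is a non-singular Jacobian representative of `m • Q`
(`nonsingular_smulTriple`), and a non-singular representative with `Z = 0` has `X ≠ 0`, `Y ≠ 0`.
[cite: SilvermanAEC2009, Exercise 3.7(d)] -/
private theorem evalEval_φ_ne_zero_aux (h : V.toAffine.Nonsingular x₀ y₀) {m : ℕ} (hm : 1 ≤ m)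
    (hψ : (V.ψ m).evalEval x₀ y₀ = 0) :
    (V.φ m).evalEval x₀ y₀ ≠ 0 ∧ Affine.Point.ωEval V x₀ y₀ m ≠ 0 := by
  classical
  obtain ⟨hns, -⟩ := Affine.Point.nonsingular_smulTriple h hm
  rw [Affine.Point.smulTriple_eq h.1] at hns
  exact ⟨Jacobian.X_ne_zero_of_Z_eq_zero hns hψ, Jacobian.Y_ne_zero_of_Z_eq_zero hns hψ⟩

/-- **Over a field, `ψₙ(Q) = 0 ⇒ φₙ(Q) ≠ 0`** for a non-singular affine point `Q = (x₀, y₀)` of any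
Weierstrass cubic and any `n ≠ 0` (then `n • Q = O` is represented by `(φₙ(Q) : ωₙ(Q) : 0)`, a
non-singular Jacobian representative, whose `X`-entry is non-zero). This is the residue-field content of
Ayad's lemma. [cite: NaskreckiVerzobio2022, Prop 3.6 (case nP = O of the proof)] -/
theorem evalEval_φ_ne_zero_of_evalEval_ψ_eq_zero (h : V.toAffine.Nonsingular x₀ y₀) {n : ℤ}
    (hn : n ≠ 0) (hψ : (V.ψ n).evalEval x₀ y₀ = 0) : (V.φ n).evalEval x₀ y₀ ≠ 0 := by
  obtain ⟨m, rfl | rfl⟩ := Int.eq_nat_or_neg n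
  · exact (evalEval_φ_ne_zero_aux h (by omega) hψ).1
  · rw [ψ_neg, evalEval_neg, neg_eq_zero] at hψ
    rw [φ_neg]
    exact (evalEval_φ_ne_zero_aux h (by omega) hψ).1

/-- **Over a field, `ψₙ(Q) = 0 ⇒ ωₙ(Q) ≠ 0`** (`n ≠ 0`, `Q` non-singular): the `Y`-entry of the
non-singular representative `(φₙ(Q) : ωₙ(Q) : 0)` of `O` is non-zero; for negative `n` use
`ω₋ₘ = ωₘ + a₁φₘψₘ + a₃ψₘ³` (`UnivEC.ω_neg`). [cite: Stange2016, §5 proof of Thm 12 ("This implies v(ω_{kn_P}) = 0")] -/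
theorem ωEval_ne_zero_of_evalEval_ψ_eq_zero (h : V.toAffine.Nonsingular x₀ y₀) {n : ℤ}
    (hn : n ≠ 0) (hψ : (V.ψ n).evalEval x₀ y₀ = 0) : Affine.Point.ωEval V x₀ y₀ n ≠ 0 := by
  obtain ⟨m, rfl | rfl⟩ := Int.eq_nat_or_neg n
  · exact (evalEval_φ_ne_zero_aux h (by omega) hψ).2
  · rw [ψ_neg, evalEval_neg, neg_eq_zero] at hψ
    have e : Affine.Point.ωEval V x₀ y₀ (-(m : ℤ)) = Affine.Point.ωEval V x₀ y₀ m := by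
      rw [Affine.Point.ωEval, Affine.Point.ωEval, UnivEC.ω_neg, map_add, map_add, map_mul, map_mul,
        map_mul, map_pow, UnivEC.map_ψ, UnivEC.curve_map_ev h.1, UnivEC.ev_xU, UnivEC.ev_yU, hψ]
      ring
    rw [e]
    exact (evalEval_φ_ne_zero_aux h (by omega) hψ).2

end Field

/-! ### Along a reduction map `f : R → k` -/

section RingHom

variable {R : Type*} [CommRing R] {k : Type*} [Field k] (f : R →+* k) {V : WeierstrassCurve R}
  {a b : R}

/-- **Ayad's lemma along a ring map to a field.** Let `f : R → k` be a ring map to a field (e.g. the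
residue map of a local ring) and `Q = (a, b)` a point of `R²` whose image is a NON-SINGULAR point of the
cubic `V.map f`. Then for every `n ≠ 0`, `f(ψₙ(Q)) = 0 ⇒ f(φₙ(Q)) ≠ 0`: `φₙ(Q)` and `ψₙ(Q)` do not both
die in `k`. [cite: NaskreckiVerzobio2022, Thm 1.1 (non-singular case) and Prop 3.6] -/
theorem map_evalEval_φ_ne_zero_of_map_evalEval_ψ_eq_zero
    (hns : (V.map f).toAffine.Nonsingular (f a) (f b)) {n : ℤ} (hn : n ≠ 0)
    (hψ : f ((V.ψ n).evalEval a b) = 0) : f ((V.φ n).evalEval a b) ≠ 0 := by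
  rw [← map_mapRingHom_evalEval, ← map_ψ] at hψ
  rw [← map_mapRingHom_evalEval, ← map_φ]
  exact evalEval_φ_ne_zero_of_evalEval_ψ_eq_zero hns hn hψ

/-- Same for `ωₙ` (the value `UnivEC.ev V a b (UnivEC.ω n)` of the universal `ωₙ` at `Q`; over a field this
is `Affine.Point.ωEval`): `f(ψₙ(Q)) = 0 ⇒ f(ωₙ(Q)) ≠ 0`. [cite: Stange2016, §5 proof of Thm 12] -/
theorem map_ev_ω_ne_zero_of_map_evalEval_ψ_eq_zero
    (hns : (V.map f).toAffine.Nonsingular (f a) (f b)) {n : ℤ} (hn : n ≠ 0)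
    (hψ : f ((V.ψ n).evalEval a b) = 0) : f (UnivEC.ev V a b (UnivEC.ω n)) ≠ 0 := by
  rw [← map_mapRingHom_evalEval, ← map_ψ] at hψ
  rw [UnivEC.map_ev]
  exact ωEval_ne_zero_of_evalEval_ψ_eq_zero hns hn hψ

/-- `φₙ(Q)` and `ψₙ(Q)` are not both killed by `f`. [cite: NaskreckiVerzobio2022, Thm 1.1 (non-singular case)] -/
theorem not_map_evalEval_ψ_eq_zero_and_map_evalEval_φ_eq_zero
    (hns : (V.map f).toAffine.Nonsingular (f a) (f b)) {n : ℤ} (hn : n ≠ 0) :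
    ¬ (f ((V.ψ n).evalEval a b) = 0 ∧ f ((V.φ n).evalEval a b) = 0) :=
  fun h => map_evalEval_φ_ne_zero_of_map_evalEval_ψ_eq_zero f hns hn h.1 h.2

end RingHom

/-! ### Local rings: Ayad's lemma as printed (`min(v(ψₙ(P)), v(φₙ(P))) = 0`) -/

section LocalRing

variable {R : Type*} [CommRing R] [IsLocalRing R] {V : WeierstrassCurve R} {a b : R}

/-- **Ayad's lemma (local form).** Let `R` be a local ring with residue field `k`, `V` a Weierstrass
equation over `R` and `Q = (a, b) ∈ R²` a point whose reduction `(ā, b̄)` is a NON-SINGULAR point of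
`V̄ = V mod 𝔪`. Then for every `n ≠ 0`: if `ψₙ(Q) ∈ 𝔪` then `φₙ(Q)` is a unit — i.e. for a discrete
valuation ring, `min(v(ψₙ(Q)), v(φₙ(Q))) = 0` («`k_{v,n} = 0`»). No minimality of `V` is needed.
[cite: NaskreckiVerzobio2022, Thm 1.1 (non-singular case, k_{v,n} = min(0, n² v(x(P)))) and Prop 3.6 with Rem 3.7 (= Ayad 1992 for number fields)] -/
theorem isUnit_evalEval_φ_of_evalEval_ψ_mem_maximalIdeal
    (hns : (V.map (IsLocalRing.residue R)).toAffine.Nonsingular (IsLocalRing.residue R a)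
      (IsLocalRing.residue R b))
    {n : ℤ} (hn : n ≠ 0) (hψ : (V.ψ n).evalEval a b ∈ IsLocalRing.maximalIdeal R) :
    IsUnit ((V.φ n).evalEval a b) := by
  rw [← IsLocalRing.residue_eq_zero_iff] at hψ
  exact isUnit_of_residue_ne_zero
    (map_evalEval_φ_ne_zero_of_map_evalEval_ψ_eq_zero (IsLocalRing.residue R) hns hn hψ)

/-- Local form for `ωₙ`: `ψₙ(Q) ∈ 𝔪 ⇒ ωₙ(Q) ∈ Rˣ`. [cite: Stange2016, §5 proof of Thm 12] -/
theorem isUnit_ev_ω_of_evalEval_ψ_mem_maximalIdeal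
    (hns : (V.map (IsLocalRing.residue R)).toAffine.Nonsingular (IsLocalRing.residue R a)
      (IsLocalRing.residue R b))
    {n : ℤ} (hn : n ≠ 0) (hψ : (V.ψ n).evalEval a b ∈ IsLocalRing.maximalIdeal R) :
    IsUnit (UnivEC.ev V a b (UnivEC.ω n)) := by
  rw [← IsLocalRing.residue_eq_zero_iff] at hψ
  exact isUnit_of_residue_ne_zero
    (map_ev_ω_ne_zero_of_map_evalEval_ψ_eq_zero (IsLocalRing.residue R) hns hn hψ)

end LocalRing

/-! ### Over `ℤ`, reduction in `ZMod ℓ` -/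

section Int

variable (V : WeierstrassCurve ℤ) {a b : ℤ}

/-- **Over `ℤ`**: if `(ā, b̄)` is a non-singular point of `V mod ℓ` (in `ZMod ℓ`) and `ℓ ∣ ψₙ(a, b)`,
`n ≠ 0`, then `ℓ ∤ φₙ(a, b)`. [cite: Stange2016, §10 proof of Lemma 29 ("g_n = gcd(φ_n, Ψ_n) is supported only on primes for which P has singular reduction")] -/
theorem not_dvd_evalEval_φ_of_dvd_evalEval_ψ {ℓ : ℕ} [Fact ℓ.Prime]
    (hns : (V.map (Int.castRingHom (ZMod ℓ))).toAffine.Nonsingular (a : ZMod ℓ) (b : ZMod ℓ))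
    {n : ℤ} (hn : n ≠ 0) (hψ : (ℓ : ℤ) ∣ (V.ψ n).evalEval a b) :
    ¬ (ℓ : ℤ) ∣ (V.φ n).evalEval a b := by
  rw [← ZMod.intCast_zmod_eq_zero_iff_dvd] at hψ ⊢
  exact map_evalEval_φ_ne_zero_of_map_evalEval_ψ_eq_zero (Int.castRingHom (ZMod ℓ)) hns hn hψ

/-- **`φₙ(P)` and `ψₙ(P)` are coprime** for an integral point `P = (a, b)` of an integral model over `ℤ`
that is non-singular modulo every prime `ℓ` dividing `ψₙ(P)` (reduction computed in `ZMod ℓ`), `n ≠ 0`.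
[cite: Stange2016, §10 proof of Lemma 29] -/
theorem isCoprime_evalEval_φ_ψ_of_zmod {n : ℤ} (hn : n ≠ 0)
    (hred : ∀ (ℓ : ℕ) [Fact ℓ.Prime], (ℓ : ℤ) ∣ (V.ψ n).evalEval a b →
      (V.map (Int.castRingHom (ZMod ℓ))).toAffine.Nonsingular (a : ZMod ℓ) (b : ZMod ℓ)) :
    IsCoprime ((V.φ n).evalEval a b) ((V.ψ n).evalEval a b) := by
  rw [Int.isCoprime_iff_nat_coprime]
  refine Nat.coprime_of_dvd fun k hk hkφ hkψ => ?_
  haveI := Fact.mk hk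
  have hψ : (k : ℤ) ∣ (V.ψ n).evalEval a b := Int.natCast_dvd.mpr hkψ
  exact V.not_dvd_evalEval_φ_of_dvd_evalEval_ψ (hred k hψ) hn hψ (Int.natCast_dvd.mpr hkφ)

/-- The arithmetic of the exact denominator: for coprime integers `φ, ψ` with `ψ ≠ 0`, the rational number
`φ/ψ²` has denominator `ψ²`. [folklore] -/
private theorem den_div_sq_eq_of_isCoprime {φ ψ : ℤ} (h : IsCoprime φ ψ) (hψ : ψ ≠ 0) :
    (((φ : ℚ) / (ψ : ℚ) ^ 2).den : ℤ) = ψ ^ 2 := by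
  have hpos : 0 < ψ ^ 2 := by positivity
  have h2 : IsCoprime φ (ψ ^ 2) := h.pow_right
  have := Rat.den_div_eq_of_coprime hpos (Int.isCoprime_iff_nat_coprime.mp h2)
  push_cast at this
  exact this

end Int

/-! ### Over `ℚ` at a prime `ℓ`, in the vocabulary of the `p`-adic height files -/

section Rat

variable (W : WeierstrassCurve ℚ) [W.IsIntegral ℤ] (ℓ : ℕ) [Fact ℓ.Prime]

/-- Residues of `ℤ_(ℓ)` vs `ℓ`-adic norms: `ā = 0 ↔ ‖a‖_ℓ < 1`. [folklore] -/
private theorem residue_eq_zero_iff_norm_lt_one (a : localIntegers ℓ) :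
    IsLocalRing.residue (localIntegers ℓ) a = 0 ↔
      ‖((algebraMap (localIntegers ℓ) ℚ a : ℚ) : ℚ_[ℓ])‖ < 1 := by
  rw [← v_algebraMap_lt_one_iff (integers_localIntegers ℓ), ratAdicValuation_apply,
    ← NNReal.coe_lt_coe, NNReal.coe_one, coe_nnnorm]

/-- Residues of `ℤ_(ℓ)` vs `ℓ`-adic norms: `ā ≠ 0 ↔ ‖a‖_ℓ = 1`. [folklore] -/
private theorem residue_ne_zero_iff_norm_eq_one (a : localIntegers ℓ) :
    IsLocalRing.residue (localIntegers ℓ) a ≠ 0 ↔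
      ‖((algebraMap (localIntegers ℓ) ℚ a : ℚ) : ℚ_[ℓ])‖ = 1 := by
  rw [← v_algebraMap_eq_one_iff (integers_localIntegers ℓ), ratAdicValuation_apply,
    ← NNReal.coe_eq_one, coe_nnnorm]

/-- **Ayad's lemma for `E(ℚ)` at a prime `ℓ`.** Let `W/ℚ` have integral coefficients, `P = (x, y) ∈ E(ℚ)`
be `ℓ`-integral (`‖x‖_ℓ ≤ 1`) with non-singular reduction modulo `ℓ` (`HasNonsingularReductionAt ℓ x y`,
e.g. automatic at a prime of good reduction for a minimal model), and `n ≠ 0`. If `‖ψₙ(P)‖_ℓ < 1` then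
`‖φₙ(P)‖_ℓ = 1` and `‖ωₙ(P)‖_ℓ = 1`; hence `‖x(nP)‖_ℓ = ‖ψₙ(P)‖_ℓ⁻²`, `‖y(nP)‖_ℓ = ‖ψₙ(P)‖_ℓ⁻³` and
`z(nP) = -x/y = -φₙψₙ/ωₙ` has `‖z(nP)‖_ℓ = ‖ψₙ(P)‖_ℓ`.
[cite: Stange2016, §5 proof of Thm 12 ("v(φ_{kn_P}) = 0. This implies v(ω_{kn_P}) = 0 … v(Θ([kn_P]P)) = v(−φψ/ω) = v(Ψ_{kn_P})")] -/
theorem norm_evalEval_φ_eq_one_of_norm_evalEval_ψ_lt_one {x y : ℚ} (h : W.toAffine.Nonsingular x y)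
    (hx : ‖(x : ℚ_[ℓ])‖ ≤ 1) (hred : W.HasNonsingularReductionAt ℓ x y) {n : ℤ} (hn : n ≠ 0)
    (hψ : ‖(((W.ψ n).evalEval x y : ℚ) : ℚ_[ℓ])‖ < 1) :
    ‖(((W.φ n).evalEval x y : ℚ) : ℚ_[ℓ])‖ = 1 ∧
      ‖((Affine.Point.ωEval W x y n : ℚ) : ℚ_[ℓ])‖ = 1 := by
  have hv := integers_localIntegers ℓ
  have hE₀ := (hasNonsingularReduction_localModel_iff (W := W) (ℓ := ℓ) h).mpr hred
  simp only [HasNonsingularReduction] at hE₀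
  rcases hE₀ with hxout | ⟨x₀, y₀, hx₀, hy₀, hns⟩
  · rw [not_mem_range_iff hv, ratAdicValuation_apply, ← NNReal.coe_lt_coe, NNReal.coe_one,
      coe_nnnorm] at hxout
    exact absurd hxout (not_lt.mpr hx)
  subst hx₀ hy₀
  -- `W = (W.localModel ℓ) ⊗ ℚ` definitionally; transport `ψₙ, φₙ, ωₙ` along `algebraMap ℤ_(ℓ) ℚ` and
  -- along the residue map
  have eψ : algebraMap (localIntegers ℓ) ℚ (((W.localModel ℓ).ψ n).evalEval x₀ y₀) =
      (W.ψ n).evalEval (algebraMap (localIntegers ℓ) ℚ x₀) (algebraMap (localIntegers ℓ) ℚ y₀) := by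
    show _ = (((W.localModel ℓ).map (algebraMap (localIntegers ℓ) ℚ)).ψ n).evalEval
      (algebraMap (localIntegers ℓ) ℚ x₀) (algebraMap (localIntegers ℓ) ℚ y₀)
    rw [map_ψ, map_mapRingHom_evalEval]
  have eφ : algebraMap (localIntegers ℓ) ℚ (((W.localModel ℓ).φ n).evalEval x₀ y₀) =
      (W.φ n).evalEval (algebraMap (localIntegers ℓ) ℚ x₀) (algebraMap (localIntegers ℓ) ℚ y₀) := by
    show _ = (((W.localModel ℓ).map (algebraMap (localIntegers ℓ) ℚ)).φ n).evalEval
      (algebraMap (localIntegers ℓ) ℚ x₀) (algebraMap (localIntegers ℓ) ℚ y₀)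
    rw [map_φ, map_mapRingHom_evalEval]
  have eω : algebraMap (localIntegers ℓ) ℚ (UnivEC.ev (W.localModel ℓ) x₀ y₀ (UnivEC.ω n)) =
      Affine.Point.ωEval W (algebraMap (localIntegers ℓ) ℚ x₀) (algebraMap (localIntegers ℓ) ℚ y₀) n := by
    show _ = UnivEC.ev ((W.localModel ℓ).map (algebraMap (localIntegers ℓ) ℚ))
      (algebraMap (localIntegers ℓ) ℚ x₀) (algebraMap (localIntegers ℓ) ℚ y₀) (UnivEC.ω n)
    exact UnivEC.map_ev _ _ _ _ _
  have hψ0 : IsLocalRing.residue (localIntegers ℓ) (((W.localModel ℓ).ψ n).evalEval x₀ y₀) = 0 := by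
    rw [residue_eq_zero_iff_norm_lt_one, eψ]; exact hψ
  refine ⟨?_, ?_⟩
  · rw [← eφ, ← residue_ne_zero_iff_norm_eq_one]
    exact map_evalEval_φ_ne_zero_of_map_evalEval_ψ_eq_zero (IsLocalRing.residue _) hns hn hψ0
  · rw [← eω, ← residue_ne_zero_iff_norm_eq_one]
    exact map_ev_ω_ne_zero_of_map_evalEval_ψ_eq_zero (IsLocalRing.residue _) hns hn hψ0

/-- The norm of `x(nP) = φₙ(P)/ψₙ(P)²` at such a prime: `‖x(nP)‖_ℓ = ‖ψₙ(P)‖_ℓ⁻¹ ^ 2`, i.e.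
`ord_ℓ den x(nP) = 2 ord_ℓ ψₙ(P)` (Stange's `v(W_n) = v(D_n)` at a prime of non-singular reduction).
[cite: Stange2016, §10 proof of Lemma 29 ("In this case, v(W_n) = v(D_n)")] -/
theorem norm_φ_div_ψ_sq_eq {x y : ℚ} (h : W.toAffine.Nonsingular x y) (hx : ‖(x : ℚ_[ℓ])‖ ≤ 1)
    (hred : W.HasNonsingularReductionAt ℓ x y) {n : ℤ} (hn : n ≠ 0)
    (hψ : ‖(((W.ψ n).evalEval x y : ℚ) : ℚ_[ℓ])‖ < 1) :
    ‖(((W.φ n).evalEval x y / (W.ψ n).evalEval x y ^ 2 : ℚ) : ℚ_[ℓ])‖ =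
      ‖(((W.ψ n).evalEval x y : ℚ) : ℚ_[ℓ])‖⁻¹ ^ 2 := by
  obtain ⟨hφ, -⟩ := W.norm_evalEval_φ_eq_one_of_norm_evalEval_ψ_lt_one ℓ h hx hred hn hψ
  push_cast
  rw [norm_div, norm_pow, hφ, one_div, inv_pow]

end Rat

/-! ### The exact denominator of `x(nP)` for an integral point -/

section ExactDenominator

variable (V : WeierstrassCurve ℤ) {a b : ℤ}

/-- `ψₙ` of the model over `ℚ` at an integral point is the integer `ψₙ(a, b)` (the division polynomials are
defined over `ℤ[a₁, …, a₆, x, y]` and commute with base change). [cite: SilvermanAEC2009, Exercise 3.7(b)] -/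
theorem evalEval_ψ_map_intCast (n : ℤ) :
    ((V.map (Int.castRingHom ℚ)).ψ n).evalEval (a : ℚ) (b : ℚ) = (((V.ψ n).evalEval a b : ℤ) : ℚ) := by
  rw [map_ψ]; exact map_mapRingHom_evalEval (Int.castRingHom ℚ) (V.ψ n) a b

/-- `φₙ` of the model over `ℚ` at an integral point is the integer `φₙ(a, b)` (base change, as for `ψₙ`).
[cite: SilvermanAEC2009, Exercise 3.7(b)] -/
theorem evalEval_φ_map_intCast (n : ℤ) :
    ((V.map (Int.castRingHom ℚ)).φ n).evalEval (a : ℚ) (b : ℚ) = (((V.φ n).evalEval a b : ℤ) : ℚ) := by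
  rw [map_φ]; exact map_mapRingHom_evalEval (Int.castRingHom ℚ) (V.φ n) a b

/-- **`φₙ(P)` and `ψₙ(P)` are coprime** for an integral point `P = (a, b)` of an integral model over `ℤ`
that has non-singular reduction — in the sense `HasNonsingularReductionAt ℓ` of the `p`-adic height files —
at every prime `ℓ ∣ ψₙ(P)` (e.g. at every prime, as for an admissible point), `n ≠ 0`.
[cite: Stange2016, §10 proof of Lemma 29] -/
theorem isCoprime_evalEval_φ_ψ (h : (V.map (Int.castRingHom ℚ)).toAffine.Nonsingular (a : ℚ) (b : ℚ))
    {n : ℤ} (hn : n ≠ 0)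
    (hred : ∀ (ℓ : ℕ) [Fact ℓ.Prime], (ℓ : ℤ) ∣ (V.ψ n).evalEval a b →
      (V.map (Int.castRingHom ℚ)).HasNonsingularReductionAt ℓ a b) :
    IsCoprime ((V.φ n).evalEval a b) ((V.ψ n).evalEval a b) := by
  haveI : (V.map (Int.castRingHom ℚ)).IsIntegral ℤ := ⟨V, rfl⟩
  rw [Int.isCoprime_iff_nat_coprime]
  refine Nat.coprime_of_dvd fun k hk hkφ hkψ => ?_
  haveI := Fact.mk hk
  have hψ : (k : ℤ) ∣ (V.ψ n).evalEval a b := Int.natCast_dvd.mpr hkψ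
  have hφ : (k : ℤ) ∣ (V.φ n).evalEval a b := Int.natCast_dvd.mpr hkφ
  have hψn : ‖((((V.map (Int.castRingHom ℚ)).ψ n).evalEval (a : ℚ) (b : ℚ) : ℚ) : ℚ_[k])‖ < 1 := by
    rw [evalEval_ψ_map_intCast, Rat.cast_intCast]
    exact Padic.norm_intCast_lt_one_iff.mpr hψ
  have hx : ‖((a : ℚ) : ℚ_[k])‖ ≤ 1 := by
    rw [Rat.cast_intCast]; exact Padic.norm_int_le_one a
  obtain ⟨hφn, -⟩ := (V.map (Int.castRingHom ℚ)).norm_evalEval_φ_eq_one_of_norm_evalEval_ψ_lt_one k h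
    hx (hred k hψ) hn hψn
  rw [evalEval_φ_map_intCast, Rat.cast_intCast] at hφn
  exact (Padic.norm_intCast_lt_one_iff.mpr hφ).ne hφn

/-- **The exact denominator of `x(nP)`** (p2's stub S2; Stange's `D_n = |W_n|` prime by prime). Let `V` be
an integral Weierstrass model over `ℤ`, `P = (a, b)` an integral point of `E = V ⊗ ℚ`, and `n` with
`ψₙ(P) ≠ 0` (i.e. `nP ≠ O`). If `P` has non-singular reduction at every prime dividing `ψₙ(P)` then
`n • P = (φₙ(P)/ψₙ(P)², ·)` and the denominator of its `x`-coordinate is EXACTLY `ψₙ(P)²`.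
[cite: Stange2016, §10 Lemma 29 and its proof ("Since P is integral, D_n ∣ W_n … v(W_n) = v(D_n)")] -/
theorem Affine.Point.exists_zsmul_eq_and_den_eq_sq
    (h : (V.map (Int.castRingHom ℚ)).toAffine.Nonsingular (a : ℚ) (b : ℚ)) {n : ℤ}
    (hψ : (V.ψ n).evalEval a b ≠ 0)
    (hred : ∀ (ℓ : ℕ) [Fact ℓ.Prime], (ℓ : ℤ) ∣ (V.ψ n).evalEval a b →
      (V.map (Int.castRingHom ℚ)).HasNonsingularReductionAt ℓ a b) :
    ∃ y₁ : ℚ, ∃ h₁ : (V.map (Int.castRingHom ℚ)).toAffine.Nonsingular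
        (((V.map (Int.castRingHom ℚ)).φ n).evalEval (a : ℚ) (b : ℚ) /
          ((V.map (Int.castRingHom ℚ)).ψ n).evalEval (a : ℚ) (b : ℚ) ^ 2) y₁,
      n • Affine.Point.some _ _ h = Affine.Point.some _ _ h₁ ∧
        ((((V.map (Int.castRingHom ℚ)).φ n).evalEval (a : ℚ) (b : ℚ) /
            ((V.map (Int.castRingHom ℚ)).ψ n).evalEval (a : ℚ) (b : ℚ) ^ 2).den : ℤ) =
          (V.ψ n).evalEval a b ^ 2 := by
  have hn : n ≠ 0 := by rintro rfl; simp [ψ_zero] at hψ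
  have hψ' : ((V.map (Int.castRingHom ℚ)).ψ n).evalEval (a : ℚ) (b : ℚ) ≠ 0 := by
    rw [evalEval_ψ_map_intCast]; exact_mod_cast hψ
  obtain ⟨y₁, h₁, e⟩ := Affine.Point.zsmul_some_eq_some_φ_div h hψ'
  refine ⟨y₁, h₁, e, ?_⟩
  rw [evalEval_ψ_map_intCast, evalEval_φ_map_intCast]
  exact den_div_sq_eq_of_isCoprime (V.isCoprime_evalEval_φ_ψ h hn hred) hψ

end ExactDenominator

end WeierstrassCurve

end
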